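import Literature.AlgebraicGeometry.Modules.IdealMul
import Literature.AlgebraicGeometry.Morphisms.CechModule
import HarnessLib

/-!
# Functoriality of `𝒥M` in the ideal sheaf; lifting morphisms into `𝒥M`; global scalars on `Ȟ¹`

Companions of `Modules/IdealMul` (the subsheaf `𝒥M ⊆ M` of an `𝒪_X`-module `M` for an ideal sheaf
`𝒥`, The Stacks Project, Tag 01CL; Görtz–Wedhorn I (7.15)):

* `idealMulMono` — **`𝒥 ≤ 𝒥'` gives `𝒥M ⟶ 𝒥'M` over `M`** (`idealMulMono_ι`; a monomorphism);
* `idealMulLift` — **a morphism `φ : N ⟶ M` all of whose sections are `𝒥`-product sections factors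
  through `𝒥M`** (`idealMulLift_ι`), the universal property of the image-type subsheaf `𝒥M`;
* `globalScalarLift` — for a global function `a ∈ Γ(X, 𝒪_X)` with `a|_V ∈ 𝒥(V)` on every affine
  open `V` (i.e. `a·𝒪_X ≤ 𝒥`), **multiplication by `a` factors as `M ⟶ 𝒥M ⟶ M`**
  (`globalScalarLift_ι`; Tag 01CL: `𝒥M` is the image of `𝒥 ⊗ M → M`);
* `cechMapH1_globalScalar_algebraMapΓ` — for an `A`-scheme `f : X → Spec A`, **the map induced on
  `Ȟ¹(𝒰, M)` by multiplication by `a ∈ A` is the `A`-module action** (Tag 01ED: functoriality of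
  the Čech complex; the `A`-module structure of `Ȟ¹(𝒰, M)` of `Morphisms/CechModule`).

Used by the crux chain W4.4 (`HomologicalConductor.NoZenoR`, S3 G-layer, Lemma L): for `t ∈ T` with
`t𝒪_X ≤ 𝒪_X(-Z)`, multiplication by `t` on `Ȟ¹(𝒰, F)` factors through `Ȟ¹(𝒰, F(-Z)) → Ȟ¹(𝒰, F)`.
Everything is proved; no named facts. Mathlib searched (pin v4.32): `PresheafOfModules.Submodule.homOfLE`
(used for `idealMulMono`), `PresheafOfModules.homMk` (used for the lift); Mathlib has no `𝒥M`.

## References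

* The Stacks Project, Tag 01CL (Modules, §17.13: the subsheaf `𝒥ℱ`), Tag 01ED (Cohomology, §20.9:
  functoriality of the Čech complex). [StacksProject]
* U. Görtz, T. Wedhorn, *Algebraic Geometry I: Schemes*, 2nd ed. (2020), (7.15) (p. 186). [GortzWedhorn2020]
-/

noncomputable section

open CategoryTheory AlgebraicGeometry TopologicalSpace Opposite

universe u v

namespace Literature.AlgebraicGeometry.Modules

open Literature.AlgebraicGeometry.Morphisms Literature.AlgebraicGeometry.Motives

variable {X : Scheme.{u}} (M : X.Modules) {J J' : X.IdealSheafData}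

/-! ## `𝒥 ≤ 𝒥'` gives `𝒥M ⟶ 𝒥'M` -/

/-- A `𝒥`-product section is a `𝒥'`-product section for `𝒥 ≤ 𝒥'`. [cite: StacksProject, Tag 01CL] -/
theorem IsIdealMulSection.mono (h : J ≤ J') {U : X.Opens} {m : Γ(M, U)}
    (hm : IsIdealMulSection M J U m) : IsIdealMulSection M J' U m := by
  intro x hx
  obtain ⟨V, hV, hxV, hmem⟩ := hm x hx
  exact ⟨V, hV, hxV, Submodule.smul_mono_left (h V) hmem⟩

/-- `𝒥M ≤ 𝒥'M` as submodules of `M` for `𝒥 ≤ 𝒥'`. [cite: StacksProject, Tag 01CL] -/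
theorem idealMulSubmodule_mono (h : J ≤ J') : idealMulSubmodule M J ≤ idealMulSubmodule M J' :=
  fun _ _ hm => IsIdealMulSection.mono M h hm

/-- **The inclusion `𝒥M ⟶ 𝒥'M` for `𝒥 ≤ 𝒥'`.** [cite: StacksProject, Tag 01CL] -/
def idealMulMono (h : J ≤ J') : idealMul M J ⟶ idealMul M J' :=
  ⟨PresheafOfModules.Submodule.homOfLE (idealMulSubmodule_mono M h)⟩

/-- `𝒥M ⟶ 𝒥'M ⟶ M` is the inclusion `𝒥M ⟶ M`. [cite: StacksProject, Tag 01CL] -/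
@[reassoc]
theorem idealMulMono_ι (h : J ≤ J') : idealMulMono M h ≫ idealMulι M J' = idealMulι M J :=
  Scheme.Modules.hom_ext _ _ fun U => by ext m; rfl

/-- Sections of `idealMulMono`: the same underlying section of `M`. [cite: StacksProject, Tag 01CL] -/
theorem idealMulι_app_idealMulMono_app (h : J ≤ J') (U : X.Opens) (m : Γ(idealMul M J, U)) :
    (idealMulι M J').app U ((idealMulMono M h).app U m) = (idealMulι M J).app U m := rfl

/-- `𝒥M ⟶ 𝒥'M` is a monomorphism. [cite: StacksProject, Tag 01CL] -/
theorem mono_idealMulMono (h : J ≤ J') : Mono (idealMulMono M h) :=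
  mono_of_mono_fac (idealMulMono_ι M h)

/-! ## Lifting a morphism into `𝒥M` -/

variable {M} {N : X.Modules}

/-- **A morphism `φ : N ⟶ M` whose sections are all `𝒥`-product sections lifts to `N ⟶ 𝒥M`.**
[cite: StacksProject, Tag 01CL] -/
def idealMulLift (φ : N ⟶ M) (hφ : ∀ (U : X.Opens) (n : Γ(N, U)), IsIdealMulSection M J U (φ.app U n)) :
    N ⟶ idealMul M J where
  val := PresheafOfModules.homMk
    { app := fun U => AddCommGrpCat.ofHom
        { toFun := fun n => (⟨φ.app U.unop n, hφ U.unop n⟩ : idealMulSubmoduleObj M J U.unop)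
          map_zero' := Subtype.ext (φ.app U.unop).hom.map_zero
          map_add' := fun n n' => Subtype.ext ((φ.app U.unop).hom.map_add n n') }
      naturality := fun {U V} g => by
        ext n
        apply Subtype.ext
        exact Scheme.Modules.Hom.app_map_apply φ g.unop n }
    (fun U s n => by
      apply Subtype.ext
      exact (φ.val.app U).hom.map_smul s n)

/-- The lift composed with `𝒥M ⟶ M` is `φ`. [cite: StacksProject, Tag 01CL] -/
@[reassoc (attr := simp)]
theorem idealMulLift_ι (φ : N ⟶ M)
    (hφ : ∀ (U : X.Opens) (n : Γ(N, U)), IsIdealMulSection M J U (φ.app U n)) :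
    idealMulLift φ hφ ≫ idealMulι M J = φ :=
  Scheme.Modules.hom_ext _ _ fun U => by ext n; rfl

/-- Sections of the lift. [cite: StacksProject, Tag 01CL] -/
theorem idealMulι_app_idealMulLift_app (φ : N ⟶ M)
    (hφ : ∀ (U : X.Opens) (n : Γ(N, U)), IsIdealMulSection M J U (φ.app U n)) (U : X.Opens)
    (n : Γ(N, U)) : (idealMulι M J).app U ((idealMulLift φ hφ).app U n) = φ.app U n := rfl

/-! ## Multiplication by a global function lying in `𝒥` factors through `𝒥M` -/

variable (M J)

/-- For `a ∈ Γ(X, 𝒪_X)` with `a|_V ∈ 𝒥(V)` on every affine open `V`, every section `a|_U • m` is a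
`𝒥`-product section. [cite: StacksProject, Tag 01CL] -/
theorem isIdealMulSection_globalScalar_app (a : Γ(X, ⊤))
    (ha : ∀ V : X.affineOpens, X.presheaf.map (homOfLE (le_top : (V : X.Opens) ≤ ⊤)).op a ∈ J.ideal V)
    (U : X.Opens) (m : Γ(M, U)) : IsIdealMulSection M J U ((globalScalar M a).app U m) := by
  intro x hx
  obtain ⟨V, hV, hxV, hVU⟩ := Opens.isBasis_iff_nbhd.mp X.isBasis_affineOpens hx
  refine ⟨⟨V, hV⟩, hVU, hxV, ?_⟩
  rw [← Scheme.Modules.Hom.app_map_apply, globalScalar_app_apply]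
  exact Submodule.smul_mem_smul (ha ⟨V, hV⟩) Submodule.mem_top

/-- **Multiplication by `a` lifted to `M ⟶ 𝒥M`** (`a ∈ Γ(X, 𝒪_X)` with `a|_V ∈ 𝒥(V)` on affine
opens). [cite: StacksProject, Tag 01CL] -/
def globalScalarLift (a : Γ(X, ⊤))
    (ha : ∀ V : X.affineOpens, X.presheaf.map (homOfLE (le_top : (V : X.Opens) ≤ ⊤)).op a ∈ J.ideal V) :
    M ⟶ idealMul M J :=
  idealMulLift (globalScalar M a) (isIdealMulSection_globalScalar_app M J a ha)

/-- `M ⟶ 𝒥M ⟶ M` is multiplication by `a`. [cite: StacksProject, Tag 01CL] -/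
@[reassoc (attr := simp)]
theorem globalScalarLift_ι (a : Γ(X, ⊤))
    (ha : ∀ V : X.affineOpens, X.presheaf.map (homOfLE (le_top : (V : X.Opens) ≤ ⊤)).op a ∈ J.ideal V) :
    globalScalarLift M J a ha ≫ idealMulι M J = globalScalar M a :=
  idealMulLift_ι _ _

/-- The criterion `a|_V ∈ 𝒥(V)` holds as soon as `a·𝒪_X ≤ 𝒥` (`ofIdealTop (span {a}) ≤ J`).
[cite: StacksProject, Tag 01CL] -/
theorem forall_map_mem_ideal_of_ofIdealTop_span_le (a : Γ(X, ⊤))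
    (h : Scheme.IdealSheafData.ofIdealTop (Ideal.span {a}) ≤ J) (V : X.affineOpens) :
    X.presheaf.map (homOfLE (le_top : (V : X.Opens) ≤ ⊤)).op a ∈ J.ideal V := by
  refine h V ?_
  rw [Scheme.IdealSheafData.ofIdealTop_ideal]
  exact Ideal.mem_map_of_mem _ (Ideal.subset_span rfl)

end Literature.AlgebraicGeometry.Modules

/-! ## Global scalars act on `Ȟ¹(𝒰, M)` through the `A`-module structure -/

namespace Literature.AlgebraicGeometry.Morphisms

open Literature.AlgebraicGeometry.Modules

variable {A : Type u} [CommRing A] {X : Scheme.{u}} (f : X ⟶ Spec (.of A)) (M : X.Modules)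
  {ι : Type v} (U : ι → X.Opens)

/-- **Multiplication by `a ∈ A` on `M` induces the `A`-action on `Ȟ¹(𝒰, M)`.**
[cite: StacksProject, Tag 01ED] -/
theorem cechMapH1_globalScalar_algebraMapΓ (a : A) (x : CechMH1 f M U) :
    cechMapH1 f (globalScalar M (algebraMapΓ f a)) U x = a • x := by
  obtain ⟨z, rfl⟩ := CechMH1.mk_surjective f M U x
  rw [cechMapH1_mk, ← map_smul]
  congr 1

/-- Hence a morphism `M ⟶ N` through which multiplication by `a` factors, `ψ ≫ ι = a•`, computes
`a • x = Ȟ¹(ι)(Ȟ¹(ψ) x)` on `Ȟ¹(𝒰, M)`. [cite: StacksProject, Tag 01ED] -/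
theorem smul_eq_cechMapH1_of_fac {N : X.Modules} (ψ : M ⟶ N) (ι' : N ⟶ M) (a : A)
    (h : ψ ≫ ι' = globalScalar M (algebraMapΓ f a)) (x : CechMH1 f M U) :
    a • x = cechMapH1 f ι' U (cechMapH1 f ψ U x) := by
  rw [← cechMapH1_comp, h, cechMapH1_globalScalar_algebraMapΓ]

end Literature.AlgebraicGeometry.Morphisms

end
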